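import Mathlib

/-!
# Route `FilamentSkeletonRss` · crux `SkeletonJ1R` (stmt-NavierStokesRegularity-23610) · registered line `streamline_kantorovich_R`
# — brick for stubs L / K: the MODEL-REGION transport estimate ("FAR: gain 1")

Lead `ns-fsr-lead-23610` (g0), `--supports stmt-NavierStokesRegularity-23610 --as helper`; pure Mathlib, Γ-free.

In the model region of the datum-sliced frame the linearised switched defect of a normal variation `Y` is, to leading order,
`−(λ Y + (7/4)τ Y′_⊥)` (L-notes §1, `SlicedModel.fderiv_apply_*`): a first-order transport equation along the arm.  This file proves the
a-priori estimate such equations carry — `norm_le_of_axial_transport`: if `y : ℝ → E` is `C¹`, `0 < τ₀ ≤ τ`, `c, λ > 0`, and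
`‖c s • y′ s + λ • y s‖ ≤ G` for `s ∈ [τ₀, τ]`, then `‖y τ‖ ≤ (τ₀/τ)^(λ/c) ‖y τ₀‖ + G/λ` (integrating factor `s^(λ/c)`).  Consequence for L: in the
model region `sup‖Y‖ ≤ ‖Y(exit of the collar)‖ + sup‖D‖/λ` — the far field pins nothing but costs nothing ("gain 1").

HONEST FRAMING.  Calculus for the ∃-side of a HYPOTHETICAL filament-type rotating-self-similar blow-up skeleton (MODEL rung, negative side); nothing
here is a claim about Navier–Stokes regularity or blow-up; stubs L, K and the crux stay OPEN.
-/

set_option linter.dupNamespace false -- `NavierStokesRegularity.NavierStokesRegularity` path/namespace repetition is the tree convention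

noncomputable section

namespace Summit.NavierStokesRegularity.NavierStokesRegularity.Theorems.SkeletonJ1RFrame

open Set Function Filter Real Topology intervalIntegral

variable {E : Type*} [NormedAddCommGroup E] [NormedSpace ℝ E] [CompleteSpace E]

/-- **Axial transport estimate ("FAR: gain 1").**  `C¹` `y`, `0 < τ₀ ≤ τ`, `0 < c`, `0 < λ`, `‖c s • y′ s + λ • y s‖ ≤ G` on `[τ₀, τ]`
⇒ `‖y τ‖ ≤ (τ₀/τ)^(λ/c) ‖y τ₀‖ + G/λ`. [folklore] -/
theorem norm_le_of_axial_transport {y : ℝ → E} (hy : ContDiff ℝ 1 y) {τ₀ τ c lam G : ℝ} (hτ₀ : 0 < τ₀) (hτ : τ₀ ≤ τ) (hc : 0 < c)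
    (hlam : 0 < lam) (hG : ∀ s ∈ Icc τ₀ τ, ‖(c * s) • deriv y s + lam • y s‖ ≤ G) :
    ‖y τ‖ ≤ (τ₀ / τ) ^ (lam / c) * ‖y τ₀‖ + G / lam := by
  set p : ℝ := lam / c with hp
  have hp0 : 0 < p := div_pos hlam hc
  have hyd : Differentiable ℝ y := hy.differentiable one_ne_zero
  have hy'c : Continuous (deriv y) := hy.continuous_deriv le_rfl
  have hG0 : 0 ≤ G := (norm_nonneg _).trans (hG τ₀ ⟨le_rfl, hτ⟩)
  -- integrating factor z s = s^p • y s, with z′ s = (1/c) s^(p-1) • (c s • y′ s + λ • y s) for s > 0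
  set z : ℝ → E := fun s => (s ^ p) • y s with hz
  have hzd : ∀ s, 0 < s → HasDerivAt z ((1 / c * s ^ (p - 1)) • ((c * s) • deriv y s + lam • y s)) s := by
    intro s hs
    have h1 : HasDerivAt (fun s : ℝ => s ^ p) (p * s ^ (p - 1)) s := by
      simpa using Real.hasDerivAt_rpow_const (p := p) (Or.inl hs.ne')
    have h2 := h1.smul (hyd s).hasDerivAt
    refine h2.congr_deriv ?_
    rw [smul_add, smul_smul, smul_smul]
    have e1 : s ^ p = 1 / c * s ^ (p - 1) * (c * s) := by
      rw [Real.rpow_sub_one hs.ne']; field_simp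
    have e2 : p * s ^ (p - 1) = 1 / c * s ^ (p - 1) * lam := by
      rw [hp]; field_simp
    rw [← e1, ← e2]
  -- integrate z′ over [τ₀, τ]
  have hzcont : ContinuousOn (fun s => (1 / c * s ^ (p - 1)) • ((c * s) • deriv y s + lam • y s)) (Icc τ₀ τ) := by
    refine ContinuousOn.smul (continuousOn_const.mul (continuousOn_id.rpow_const fun s hs => Or.inl (by linarith [hs.1] : s ≠ 0))) ?_
    exact (((continuous_const.mul continuous_id).smul hy'c).add (continuous_const.smul hyd.continuous)).continuousOn
  have hFTC : ∫ s in τ₀..τ, (1 / c * s ^ (p - 1)) • ((c * s) • deriv y s + lam • y s) = z τ - z τ₀ := by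
    refine integral_eq_sub_of_hasDerivAt (fun s hs => hzd s ?_) (hzcont.intervalIntegrable_of_Icc hτ)
    rw [uIcc_of_le hτ] at hs; linarith [hs.1]
  -- bound the integral
  have hbound : ‖z τ - z τ₀‖ ≤ G / c * ((τ ^ p - τ₀ ^ p) / p) := by
    rw [← hFTC]
    have h1 : ‖∫ s in τ₀..τ, (1 / c * s ^ (p - 1)) • ((c * s) • deriv y s + lam • y s)‖ ≤ ∫ s in τ₀..τ, G / c * s ^ (p - 1) := by
      refine norm_integral_le_of_norm_le hτ (Filter.Eventually.of_forall fun s hs => ?_) ?_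
      · have hs0 : 0 < s := by linarith [hs.1]
        rw [norm_smul, Real.norm_of_nonneg (by positivity : 0 ≤ 1 / c * s ^ (p - 1))]
        have := hG s ⟨hs.1.le, hs.2⟩
        calc 1 / c * s ^ (p - 1) * ‖(c * s) • deriv y s + lam • y s‖ ≤ 1 / c * s ^ (p - 1) * G :=
              mul_le_mul_of_nonneg_left this (by positivity)
          _ = G / c * s ^ (p - 1) := by ring
      · exact (continuousOn_const.mul (continuousOn_id.rpow_const fun s hs => Or.inl
          (by rw [uIcc_of_le hτ] at hs; linarith [hs.1] : s ≠ 0))).intervalIntegrable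
    refine h1.trans (le_of_eq ?_)
    have h0 : (0:ℝ) ∉ uIcc τ₀ τ := by rw [uIcc_of_le hτ]; exact fun h0 => by linarith [h0.1]
    rw [intervalIntegral.integral_const_mul, integral_rpow (Or.inr ⟨by linarith, h0⟩), show p - 1 + 1 = p by ring]
  -- conclude
  have hτpos : 0 < τ := lt_of_lt_of_le hτ₀ hτ
  have hτp : 0 < τ ^ p := Real.rpow_pos_of_pos hτpos p
  have hzτ : z τ = (τ ^ p) • y τ := rfl
  have hzτ₀ : z τ₀ = (τ₀ ^ p) • y τ₀ := rfl
  have hy_eq : y τ = (τ ^ p)⁻¹ • z τ := by rw [hzτ, smul_smul, inv_mul_cancel₀ hτp.ne', one_smul]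
  have hnz : ‖z τ‖ ≤ τ₀ ^ p * ‖y τ₀‖ + G / c * ((τ ^ p - τ₀ ^ p) / p) := by
    have h1 : ‖z τ‖ ≤ ‖z τ₀‖ + ‖z τ - z τ₀‖ := by
      calc ‖z τ‖ = ‖z τ₀ + (z τ - z τ₀)‖ := by rw [add_sub_cancel]
        _ ≤ ‖z τ₀‖ + ‖z τ - z τ₀‖ := norm_add_le _ _
    have h2 : ‖z τ₀‖ = τ₀ ^ p * ‖y τ₀‖ := by
      rw [hzτ₀, norm_smul, Real.norm_of_nonneg (Real.rpow_nonneg hτ₀.le p)]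
    linarith
  rw [hy_eq, norm_smul, norm_inv, Real.norm_of_nonneg hτp.le]
  have hratio : (τ₀ / τ) ^ p = τ₀ ^ p * (τ ^ p)⁻¹ := by
    rw [Real.div_rpow hτ₀.le hτpos.le, div_eq_mul_inv]
  rw [hratio]
  have hkey : (τ ^ p)⁻¹ * (G / c * ((τ ^ p - τ₀ ^ p) / p)) ≤ G / lam := by
    have hcp : c * p = lam := by rw [hp]; field_simp
    have h1 : G / c * ((τ ^ p - τ₀ ^ p) / p) ≤ G / c * (τ ^ p / p) := by
      apply mul_le_mul_of_nonneg_left _ (by positivity)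
      apply div_le_div_of_nonneg_right _ hp0.le
      linarith [Real.rpow_nonneg hτ₀.le p]
    calc (τ ^ p)⁻¹ * (G / c * ((τ ^ p - τ₀ ^ p) / p)) ≤ (τ ^ p)⁻¹ * (G / c * (τ ^ p / p)) :=
          mul_le_mul_of_nonneg_left h1 (by positivity)
      _ = G / (c * p) := by field_simp
      _ = G / lam := by rw [hcp]
  calc (τ ^ p)⁻¹ * ‖z τ‖ ≤ (τ ^ p)⁻¹ * (τ₀ ^ p * ‖y τ₀‖ + G / c * ((τ ^ p - τ₀ ^ p) / p)) :=
        mul_le_mul_of_nonneg_left hnz (by positivity)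
    _ = τ₀ ^ p * (τ ^ p)⁻¹ * ‖y τ₀‖ + (τ ^ p)⁻¹ * (G / c * ((τ ^ p - τ₀ ^ p) / p)) := by ring
    _ ≤ τ₀ ^ p * (τ ^ p)⁻¹ * ‖y τ₀‖ + G / lam := by linarith

end Summit.NavierStokesRegularity.NavierStokesRegularity.Theorems.SkeletonJ1RFrame

end
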